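import Literature.GroupTheory.CombinatorialGroupTheory.QuadraticWordsGathering
import Literature.Topology.FourManifolds.SurfaceGroupEpimorphismsProofs
import Mathlib.GroupTheory.PresentedGroup
import Mathlib.Data.Fintype.Prod
import HarnessLib

/-!
# The normal form of a nondegenerate quadratic word: one-relator surface groups

Topic `Literature/GroupTheory/CombinatorialGroupTheory`.  Zieschang–Vogt–Coldewey, *Surfaces and
Planar Discontinuous Groups*, LNM 835 (1980), §3.2: every system of pairs of sides of a polygon is
carried by bifurcations to a canonical normal form (Thm. 3.2.6 "gathering handles", Dehn /
Brahana), and for a ONE-VERTEX orientable scheme with `2h` pairs the normal form is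
`∏_{i<h} [aᵢ, bᵢ]` (3.1.8: `2 - 2g = V - m + 1`).  Algebraically (ZVC 3.2.4 / 5.2.4: bifurcations
are automorphisms of the free group on the sides): **if `w` is an alternating quadratic word over a
finite alphabet `ι`, using every symbol, with nondegenerate intersection form, then `|ι| = 2h` and
some isomorphism `F(a₁, b₁, …, a_h, b_h) ≅ F(ι)` carries the surface relator `∏ [aᵢ, bᵢ]` to a
conjugate of `w`; hence the one-relator group `⟨ι ∣ w⟩` is the surface group `S_h`.**

The gathering itself is the tree's `exists_blocks_of_terminal` (`QuadraticWordsGathering.lean`,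
run at the trivial assignment, where every pattern is terminal); here we add the bookkeeping:
the commutator blocks enumerate the symbols (`|ι| = 2h`), a signed relabelling
(`Literature.Topology.FourManifolds.SurfaceGroup.signedRelabel`) followed by a renaming of the
generators carries `∏ [aᵢ, bᵢ]` to the block word, and an isomorphism of free groups carrying one
relator to a conjugate of another induces an isomorphism of the one-relator groups
(`nonempty_presentedGroup_mulEquiv_of_map_eq_conj`).  Nondegeneracy holds in particular for
one-vertex words (`OneVertex.nondeg`, `QuadraticWordsVertices.lean`) — the form in which the
Reidemeister–Schreier computation of finite-index subgroups of surface groups (ZVC 4.14.22)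
delivers its relator.

Main results: `exists_mulEquiv_map_surfaceRelator_of_nondeg`,
`nonempty_presentedGroup_mulEquiv_surfaceGroup_of_nondeg`, `card_eq_two_mul_of_nondeg`.

## References

* H. Zieschang, E. Vogt, H.-D. Coldewey, *Surfaces and Planar Discontinuous Groups*, LNM 835,
  Springer 1980, §3.1 (3.1.8), §3.2 (3.2.4, Thm. 3.2.6), §5.2 (5.2.4). [ZieschangVogtColdewey1980]
* R. C. Lyndon, P. E. Schupp, *Combinatorial Group Theory* (2001), Ch. I §7 (quadratic words,
  Prop. 7.6). [LyndonSchupp2001]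
-/

namespace Literature.GroupTheory.CombinatorialGroupTheory

open List Literature.Topology.FourManifolds

/-! ### One-relator groups along isomorphisms of free groups -/

/-- Conjugate relators have the same normal closure. [folklore] -/
private theorem normalClosure_singleton_conj {G : Type*} [Group G] (c r : G) :
    Subgroup.normalClosure ({c * r * c⁻¹} : Set G) = Subgroup.normalClosure {r} := by
  apply le_antisymm
  · refine Subgroup.normalClosure_le_normal (Set.singleton_subset_iff.2 ?_)
    exact Subgroup.normalClosure_normal.conj_mem r
      (Subgroup.subset_normalClosure (Set.mem_singleton r)) c
  · refine Subgroup.normalClosure_le_normal (Set.singleton_subset_iff.2 ?_)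
    have h := Subgroup.normalClosure_normal.conj_mem (c * r * c⁻¹)
      (Subgroup.subset_normalClosure (Set.mem_singleton (c * r * c⁻¹))) c⁻¹
    simpa [mul_assoc] using h

/-- **An isomorphism of free groups carrying one relator to a conjugate of another induces an
isomorphism of the one-relator groups** (Tietze; ZVC 5.2.4 "related binary products define
isomorphic groups"). [cite: ZieschangVogtColdewey1980, 5.2.4] -/
theorem nonempty_presentedGroup_mulEquiv_of_map_eq_conj {α β : Type*} (Λ : FreeGroup α ≃* FreeGroup β)
    (r : FreeGroup α) (r' c : FreeGroup β) (h : Λ r = c * r' * c⁻¹) :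
    Nonempty (PresentedGroup ({r} : Set (FreeGroup α)) ≃* PresentedGroup ({r'} : Set (FreeGroup β))) :=
  ⟨QuotientGroup.congr (Subgroup.normalClosure ({r} : Set (FreeGroup α)))
      (Subgroup.normalClosure ({r'} : Set (FreeGroup β))) Λ (by
        rw [Subgroup.map_normalClosure _ _ (by exact Λ.surjective), Set.image_singleton,
          MonoidHom.coe_coe, h]
        exact normalClosure_singleton_conj c r')⟩

/-! ### The symbols of a block word -/

variable {ι : Type*} [DecidableEq ι]

/-- An alternating quadratic word has no repeated letter. [folklore] -/
private theorem IsQuadratic.nodup {w : List (ι × Bool)} (hq : IsQuadratic w) : w.Nodup :=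
  nodup_iff_count_le_one.2 fun x => by rw [count_eq_countP]; exact hq.count_le_one x

/-- An alternating quadratic word over a finite alphabet using every symbol has length `2 |ι|`.
[folklore] -/
private theorem IsQuadratic.length_eq_two_mul_card [Fintype ι] {w : List (ι × Bool)}
    (hq : IsQuadratic w) (hall : ∀ i, (i, true) ∈ w) : w.length = 2 * Fintype.card ι := by
  classical
  have hmem : ∀ x : ι × Bool, x ∈ w := by
    rintro ⟨i, _ | _⟩
    · exact hq.partner_mem (hall i)
    · exact hall i
  have huniv : w.toFinset = Finset.univ := Finset.eq_univ_iff_forall.2 fun x => mem_toFinset.2 (hmem x)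
  rw [← toFinset_card_of_nodup hq.nodup, huniv, Finset.card_univ, Fintype.card_prod, Fintype.card_bool]
  ring

/-! ### The normal form -/

/-- **Normal form of a nondegenerate quadratic word** (ZVC Thm. 3.2.6 with 3.1.8, via the
bifurcations 3.2.4 / 5.2.4 realised as automorphisms): if `w` is an alternating quadratic word over
the finite alphabet `ι` in which every symbol occurs and whose intersection form is nondegenerate,
then `|ι| = 2h` for some `h` and there is an isomorphism `Λ : F(a₁, b₁, …, a_h, b_h) ≅ F(ι)` with
`Λ(∏ [aᵢ, bᵢ])` conjugate to `w`. [cite: ZieschangVogtColdewey1980, Thm 3.2.6 / 3.1.8] -/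
theorem exists_mulEquiv_map_surfaceRelator_of_nondeg [Fintype ι] {w : List (ι × Bool)}
    (hq : IsQuadratic w) (hall : ∀ i, (i, true) ∈ w) (hN : Nondeg w) :
    ∃ h : ℕ, Fintype.card ι = 2 * h ∧
      ∃ (Λ : FreeGroup (surfaceGen h) ≃* FreeGroup ι) (c : FreeGroup ι),
        Λ (surfaceRelator h) = c * FreeGroup.mk w * c⁻¹ := by
  classical
  -- Zieschang's gathering of handles, at the trivial assignment (every pattern is terminal)
  have hZ : FreeGroup.mk (w.filter fun x => decide ¬ ((fun _ : ι => (1 : Multiplicative ℤ)) x.1 = 1)) = 1 := by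
    rw [filter_eq_nil_iff.2 fun x _ => by simp]; rfl
  obtain ⟨bs, Θ, c, hperm, hcert, -⟩ := exists_blocks_of_terminal (fun _ : ι => (1 : Multiplicative ℤ)) hq hN hZ
  -- counting: `|w| = 2 |ι| = 4 |bs|`
  set h := bs.length with hh
  have hlenw := hq.length_eq_two_mul_card hall
  have hcard : Fintype.card ι = 2 * h := by
    have h1 := hperm.length_eq
    rw [length_blocksWord, hlenw] at h1
    omega
  refine ⟨h, hcard, ?_⟩
  -- the blocks as a function of `Fin h`
  set B : Fin h → Block ι := fun i => bs.get (i.cast hh) with hB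
  have hbs : bs = (List.finRange h).map B := by
    apply List.ext_get (by simp [hh]) fun n h₁ h₂ => ?_
    simp [hB]
  have hbw : blocksWord bs = (List.finRange h).flatMap fun i => (B i).word := by
    conv_lhs => rw [hbs]
    rw [blocksWord, flatMap_map]
  -- the symbols of the blocks are pairwise distinct
  have hnodup : ((List.finRange h).flatMap fun i => (B i).word).Nodup := hbw ▸ hperm.nodup_iff.2 hq.nodup
  have hnd : ∀ i, (B i).word.Nodup := fun i => (nodup_flatMap.1 hnodup).1 i (mem_finRange i)
  have hpair : ∀ i j : Fin h, i ≠ j → Disjoint (B i).word (B j).word := by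
    intro i j hij
    have hP := (nodup_flatMap.1 hnodup).2
    obtain ⟨l₁, l₂, hl⟩ := append_of_mem (mem_finRange i)
    rw [hl, pairwise_append, pairwise_cons] at hP
    have hj : j ∈ l₁ ++ i :: l₂ := hl ▸ mem_finRange j
    rcases mem_append.1 hj with hj | hj
    · exact (hP.2.2 j hj i mem_cons_self).symm
    · rcases mem_cons.1 hj with rfl | hj
      · exact absurd rfl hij
      · exact hP.2.1.1 j hj
  -- the renaming `aᵢ ↦ qᵢ`, `bᵢ ↦ zᵢ` and the signs
  let π₀ : surfaceGen h → ι := fun x => bif x.2 then (B x.1).z else (B x.1).q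
  let ε : surfaceGen h → Bool := fun x => bif x.2 then (B x.1).σ else (B x.1).s
  have hsym : ∀ (x : surfaceGen h) (t : Bool), (π₀ x, t) ∈ (B x.1).word := by
    rintro ⟨i, _ | _⟩ t
    · rcases Bool.eq_false_or_eq_true t with rfl | rfl <;>
        rcases Bool.eq_false_or_eq_true (B i).s with e | e <;> simp [π₀, Block.word, e]
    · rcases Bool.eq_false_or_eq_true t with rfl | rfl <;>
        rcases Bool.eq_false_or_eq_true (B i).σ with e | e <;> simp [π₀, Block.word, e]
  have hπ₀ : Function.Injective π₀ := by
    rintro ⟨i, t⟩ ⟨j, u⟩ hxy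
    change π₀ (i, t) = π₀ (j, u) at hxy
    by_cases hij : i = j
    · subst hij
      by_contra hne
      have htu : t ≠ u := fun e => hne (by rw [e])
      have hqz : (B i).q = (B i).z := by
        cases t <;> cases u
        · exact absurd rfl htu
        · simpa [π₀] using hxy
        · simpa [π₀] using hxy.symm
        · exact absurd rfl htu
      have hn := hnd i
      simp only [Block.word, hqz, nodup_cons, mem_cons, not_mem_nil, or_false, Prod.mk.injEq,
        true_and, not_or] at hn
      obtain ⟨⟨h1, -, h3⟩, -⟩ := hn
      revert h1 h3
      cases (B i).s <;> cases (B i).σ <;> simp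
    · exact (hpair i j hij (hsym (i, t) true) (hxy ▸ hsym (j, u) true)).elim
  have hbij : Function.Bijective π₀ :=
    (Fintype.bijective_iff_injective_and_card π₀).2
      ⟨hπ₀, by rw [hcard, Fintype.card_prod, Fintype.card_fin, Fintype.card_bool]; ring⟩
  let π : surfaceGen h ≃ ι := Equiv.ofBijective π₀ hbij
  -- the isomorphism of free groups `xᵢ ↦ x_{π i}^{(ε i)}` carries the relator to the block word
  let Ψ : FreeGroup (surfaceGen h) ≃* FreeGroup ι :=
    (SurfaceGroup.signedRelabel (Equiv.refl _) ε).trans (FreeGroup.freeGroupCongr π)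
  have hΨ : Ψ (surfaceRelator h) = FreeGroup.mk (blocksWord bs) := by
    rw [← SurfaceGroup.mk_surfaceWordStd, MulEquiv.trans_apply, SurfaceGroup.signedRelabel_mk,
      FreeGroup.freeGroupCongr_apply, FreeGroup.map.mk, map_map, hbw, surfaceWordStd, map_flatMap]
    congr 1
  refine ⟨Ψ.trans Θ, c, ?_⟩
  rw [MulEquiv.trans_apply, hΨ, hcert]

/-- **The one-relator group of a nondegenerate quadratic word is a surface group**: under the
hypotheses of `exists_mulEquiv_map_surfaceRelator_of_nondeg`, `⟨ι ∣ w⟩ ≅ S_h` with `|ι| = 2h`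
(ZVC Thm. 3.2.6 / 3.1.8; Lyndon–Schupp I Prop. 7.6). [cite: ZieschangVogtColdewey1980, Thm 3.2.6 / 3.1.8] -/
theorem nonempty_presentedGroup_mulEquiv_surfaceGroup_of_nondeg [Fintype ι] {w : List (ι × Bool)}
    (hq : IsQuadratic w) (hall : ∀ i, (i, true) ∈ w) (hN : Nondeg w) :
    ∃ h : ℕ, Fintype.card ι = 2 * h ∧
      Nonempty (PresentedGroup ({FreeGroup.mk w} : Set (FreeGroup ι)) ≃* SurfaceGroup h) := by
  obtain ⟨h, hcard, Λ, c, hΛ⟩ := exists_mulEquiv_map_surfaceRelator_of_nondeg hq hall hN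
  obtain ⟨e⟩ := nonempty_presentedGroup_mulEquiv_of_map_eq_conj Λ (surfaceRelator h) (FreeGroup.mk w) c hΛ
  exact ⟨h, hcard, ⟨e.symm⟩⟩

/-- The genus is determined by the alphabet: with `|ι| = 2h` fixed in advance, `⟨ι ∣ w⟩ ≅ S_h`.
[cite: ZieschangVogtColdewey1980, Thm 3.2.6 / 3.1.8] -/
theorem nonempty_presentedGroup_mulEquiv_surfaceGroup_of_nondeg_of_card [Fintype ι] {w : List (ι × Bool)}
    (hq : IsQuadratic w) (hall : ∀ i, (i, true) ∈ w) (hN : Nondeg w) {h : ℕ}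
    (hcard : Fintype.card ι = 2 * h) :
    Nonempty (PresentedGroup ({FreeGroup.mk w} : Set (FreeGroup ι)) ≃* SurfaceGroup h) := by
  obtain ⟨h', hcard', he⟩ := nonempty_presentedGroup_mulEquiv_surfaceGroup_of_nondeg hq hall hN
  obtain rfl : h = h' := by omega
  exact he

end Literature.GroupTheory.CombinatorialGroupTheory
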